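import Summits.HubbardSuperconductivity.HubbardSuperconductivity.Theorems.BalabanIRBirEveryGroundStateDarkSets
import Summits.HubbardSuperconductivity.HubbardSuperconductivity.Theorems.BalabanIRBirEveryGroundState
import Summits.HubbardSuperconductivity.HubbardSuperconductivity.Theorems.BalabanIRBirEveryGroundStateBaire
import Summits.HubbardSuperconductivity.HubbardSuperconductivity.Theorems.BalabanIRBirGroundStateAverageLROBoundedMultiplicity
import Summits.HubbardSuperconductivity.HubbardSuperconductivity.Theorems.BalabanIRBirEveryGroundStateUniqueGroundClosers
import HarnessLib

/-!
# Crux `BirEveryGroundState` (item `stmt-HubbardSuperconductivity-2083`): the dense-brightness closure and the dark-interval normal form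

Helper file `--supports stmt-HubbardSuperconductivity-2083`
(`Summit.HubbardSuperconductivity.HubbardSuperconductivity.Theses.BalabanIR.BirEveryGroundState`,
crux 5 of route BalabanIR). It draws, for the crux BY NAME, the consequences of the Theses-free
module `…BirEveryGroundStateDarkSets` (dark coupling sets are closed; Baire selection):

* `birEveryGroundState_of_denseBright` — **closure.** The crux follows as soon as, on every window
  carrying its average hypothesis, there are a sub-window `(a, b)`, ONE constant `c' > 0` and ONE
  threshold `L₀` such that at EACH even side `L ≥ L₀` separately the `c' L⁴`-bright couplings
  (every normalised sector ground state has `c' L⁴ < Re ⟨ψ, Δ_d† Δ_d ψ⟩`) are dense in `(a, b)`.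
  This is a per-side hypothesis: no coupling has to be good at two sides at once (Baire does the
  diagonal selection), and nothing is asked about the dimension or the symmetry type of the
  ground eigenspace (compare `birEveryGroundState_of_scalarOnGround`, which wants scalar ground
  compressions at ONE coupling for all large sides, and `avgToEvery_at_of_eventualSimplicity`,
  which wants simplicity at one coupling for all large sides).
* `exists_darkInterval_of_not_birEveryGroundState` — **normal form of a counterexample** (the
  contrapositive): if the crux fails, then on some doped repulsive window carrying the average
  bound, for every sub-window, every `c' > 0` and every threshold there is an even side `L` beyond
  the threshold and a whole coupling INTERVAL every point of which carries a `c' L⁴`-dark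
  normalised sector ground state at side `L`.
* `exists_degenerateInterval_of_not_birEveryGroundState` — hence (uniformising the average bound
  on a sub-window by Baire, `birAvgHyp_uniform_on_dense_subwindow`, and passing it to every
  coupling as a trace floor, `le_re_trace_groundProj_mul_of_mem_closure`): if the crux fails,
  then for infinitely many even sides `L` the sector ground eigenspace of `hubbardTorus 2 L 1 U` is
  DEGENERATE (`dim ≥ 2`) at EVERY coupling of a non-trivial interval — a permanent degeneracy of
  the doped repulsive Hubbard torus robust under variation of `U`, at infinitely many sizes.

So a refutation of the crux needs (besides the average bound on a window, the open target
`BirGroundStateAverageLRO` there) interval-robust ground-state degeneracies at infinitely many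
sides; and a proof needs only per-side density of bright couplings. Folklore finite-dimensional
spectral theory and point-set topology; no definitions, no named facts.
-/

noncomputable section

-- the mandated namespace `Summit.<Summit>.<Problem>.Theorems` repeats `HubbardSuperconductivity`
-- (single-problem summit, D-0017), which the `dupNamespace` linter flags on every declaration
set_option linter.dupNamespace false

namespace Summit.HubbardSuperconductivity.HubbardSuperconductivity.Theorems

open Matrix Set Filter Topology
open Literature.Probability.LatticeModels Literature.MathematicalPhysics.QuantumLattice
open Summit.HubbardSuperconductivity.HubbardSuperconductivity.Theses.BalabanIR
open scoped ComplexOrder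

/-! ### The closure: per-side dense brightness ⇒ the crux -/

/-- **`BirEveryGroundState` ⇐ per-side dense brightness on every window carrying the average
bound.** Suppose that for all data `(δ, U₁, U₂, c)` of the crux and under its window-average
hypothesis there are a sub-window `[a, b] ⊆ [U₁, U₂]` (`a < b`), a constant `c' > 0` and a
threshold `L₀` such that for EACH even side `L ≥ L₀` the couplings `U` at which every normalised
`(2⌊(1-δ)L²/2⌋, S^z = 0)`-sector ground state of `hubbardTorus 2 L 1 U` has
`c' L⁴ < Re ⟨ψ, Δ_d† Δ_d ψ⟩` meet every sub-interval of `(a, b)`. Then the crux holds: Baire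
selection (`exists_everyGroundStateLRO_of_denseBright`) gives one coupling of `(a, b) ⊆ (U₁, U₂)`
bright at every even side `L ≥ L₀`, where every admissible ground-state sequence has pair-field
long-range order. Baire (1899); Kato (1966) II-§5.1. [folklore] -/
theorem birEveryGroundState_of_denseBright
    (h : ∀ (δ U₁ U₂ c : ℝ), δ ∈ Set.Ioo (0:ℝ) (1/2) → 0 < U₁ → U₁ < U₂ → 0 < c →
      (∀ U ∈ Set.Ioo U₁ U₂, ∃ L₀ : ℕ, ∀ (L : ℕ) [NeZero L], L₀ ≤ L → Even L →
        let N : ℕ := 2 * ⌊(1 - δ) * (L : ℝ) ^ 2 / 2⌋₊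
        let H := hubbardTorus 2 L 1 U
        let S := szSector (Λ := FermionTorus 2 L) N 0
        let E₀ := S ⊓ Module.End.eigenspace (Matrix.toLin' H) ((H.minEnergyOn S : ℝ) : ℂ)
        let P := projMatrix (E₀.map (Fock.toEuclidean (ι := Orb (FermionTorus 2 L)) :
          Fock (Orb (FermionTorus 2 L)) →ₗ[ℂ] EuclideanSpace ℂ (Finset (Orb (FermionTorus 2 L)))))
        c * (L : ℝ) ^ 4 * P.trace.re ≤
          (P * ((pairField dWaveFormFactor L)ᴴ * pairField dWaveFormFactor L)).trace.re) →
      ∃ a b c' : ℝ, U₁ ≤ a ∧ a < b ∧ b ≤ U₂ ∧ 0 < c' ∧ ∃ L₀ : ℕ,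
        ∀ (L : ℕ) [NeZero L], L₀ ≤ L → Even L → ∀ u v : ℝ, a ≤ u → u < v → v ≤ b →
          ∃ U ∈ Set.Ioo u v, ∀ ψ : Fock (Orb (FermionTorus 2 L)),
            IsGroundStateInSector (hubbardTorus 2 L 1 U) (2 * ⌊(1 - δ) * (L : ℝ) ^ 2 / 2⌋₊) 0 ψ →
            star ψ ⬝ᵥ ψ = 1 →
            c' * (L : ℝ) ^ 4 <
              (star ψ ⬝ᵥ ((pairField dWaveFormFactor L)ᴴ * pairField dWaveFormFactor L) *ᵥ
                ψ).re) :
    BirEveryGroundState := by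
  intro δ U₁ U₂ c hδ hU₁ hU₁₂ hc hyp
  obtain ⟨a, b, c', ha, hab, hb, hc', L₀, hd⟩ := h δ U₁ U₂ c hδ hU₁ hU₁₂ hc hyp
  have hδ' : -1 ≤ δ := by linarith [hδ.1]
  obtain ⟨U, hUab, hLRO⟩ := exists_everyGroundStateLRO_of_denseBright hδ' hab hc' L₀ hd
  exact ⟨U, ⟨lt_of_le_of_lt ha hUab.1, lt_of_lt_of_le hUab.2 hb⟩, hLRO⟩

/-! ### The normal form of a counterexample: dark intervals at infinitely many sides -/

/-- **Normal form of `¬ BirEveryGroundState`: interval darkness infinitely often.** If the crux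
fails then there are data `δ ∈ (0, ½)`, `0 < U₁ < U₂`, `c > 0` such that (i) the crux's
window-average hypothesis holds on `(U₁, U₂)` with constant `c`, and (ii) for every sub-window
`[a, b] ⊆ [U₁, U₂]`, every `c' > 0` and every threshold `L₀` there are an even side `L ≥ L₀`
(`L ≠ 0`) and a non-trivial coupling interval `(u, v) ⊆ [a, b]` EVERY point `U` of which admits a
normalised `(2⌊(1-δ)L²/2⌋, S^z = 0)`-sector ground state `ψ` of `hubbardTorus 2 L 1 U` with
`Re ⟨ψ, Δ_d† Δ_d ψ⟩ ≤ c' L⁴` (a `c' L⁴`-dark ground direction on a whole interval of couplings).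
This is the contrapositive of `birEveryGroundState_of_denseBright` (dark sets are closed, so
"bright couplings not dense" means "dark on an interval"). [folklore] -/
theorem exists_darkInterval_of_not_birEveryGroundState (hS : ¬ BirEveryGroundState) :
    ∃ (δ U₁ U₂ c : ℝ), δ ∈ Set.Ioo (0:ℝ) (1/2) ∧ 0 < U₁ ∧ U₁ < U₂ ∧ 0 < c ∧
      (∀ U ∈ Set.Ioo U₁ U₂, ∃ L₀ : ℕ, ∀ (L : ℕ) [NeZero L], L₀ ≤ L → Even L →
        let N : ℕ := 2 * ⌊(1 - δ) * (L : ℝ) ^ 2 / 2⌋₊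
        let H := hubbardTorus 2 L 1 U
        let S := szSector (Λ := FermionTorus 2 L) N 0
        let E₀ := S ⊓ Module.End.eigenspace (Matrix.toLin' H) ((H.minEnergyOn S : ℝ) : ℂ)
        let P := projMatrix (E₀.map (Fock.toEuclidean (ι := Orb (FermionTorus 2 L)) :
          Fock (Orb (FermionTorus 2 L)) →ₗ[ℂ] EuclideanSpace ℂ (Finset (Orb (FermionTorus 2 L)))))
        c * (L : ℝ) ^ 4 * P.trace.re ≤
          (P * ((pairField dWaveFormFactor L)ᴴ * pairField dWaveFormFactor L)).trace.re) ∧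
      ∀ a b c' : ℝ, U₁ ≤ a → a < b → b ≤ U₂ → 0 < c' → ∀ L₀ : ℕ,
        ∃ (L : ℕ) (_ : NeZero L), L₀ ≤ L ∧ Even L ∧ ∃ u v : ℝ, a ≤ u ∧ u < v ∧ v ≤ b ∧
          ∀ U ∈ Set.Ioo u v, ∃ ψ : Fock (Orb (FermionTorus 2 L)),
            IsGroundStateInSector (hubbardTorus 2 L 1 U) (2 * ⌊(1 - δ) * (L : ℝ) ^ 2 / 2⌋₊) 0 ψ ∧
            star ψ ⬝ᵥ ψ = 1 ∧
            (star ψ ⬝ᵥ ((pairField dWaveFormFactor L)ᴴ * pairField dWaveFormFactor L) *ᵥ ψ).re ≤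
              c' * (L : ℝ) ^ 4 := by
  by_contra hcon
  refine hS (birEveryGroundState_of_denseBright fun δ U₁ U₂ c hδ hU₁ hU₁₂ hc hyp => ?_)
  by_contra hneg
  refine hcon ⟨δ, U₁, U₂, c, hδ, hU₁, hU₁₂, hc, hyp, fun a b c' ha hab hb hc' L₀ => ?_⟩
  by_contra hL
  refine hneg ⟨a, b, c', ha, hab, hb, hc', L₀, fun L _ hL₀ hE u v hu huv hv => ?_⟩
  by_contra hU
  refine hL ⟨L, ‹NeZero L›, hL₀, hE, u, v, hu, huv, hv, fun U hUuv => ?_⟩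
  by_contra hψ
  refine hU ⟨U, hUuv, fun ψ hgs h1 => ?_⟩
  by_contra hlt
  exact hψ ⟨ψ, hgs, h1, not_lt.1 hlt⟩

/-! ### Consequence: permanent degeneracy on coupling intervals at infinitely many sides -/

/-- **`¬ BirEveryGroundState` forces interval-robust ground-state degeneracy at infinitely many
sides.** If the crux fails, there are `δ ∈ (0, ½)`, a repulsive window `0 < U₁ < U₂` and `c > 0`
with the crux's window-average hypothesis on `(U₁, U₂)` such that: for every sub-window
`[a, b] ⊆ [U₁, U₂]` and every threshold `L₀` some even side `L ≥ L₀` (`L ≠ 0`) and some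
non-trivial coupling interval `(u, v) ⊆ [a, b]` have, at EVERY `U ∈ (u, v)`, (i) the trace floor
`c L⁴ ≤ re tr (P Δ_d†Δ_d)` on the `(2⌊(1-δ)L²/2⌋, S^z = 0)`-sector ground eigenspace `E₀(U, L)` of
`hubbardTorus 2 L 1 U` (`P` its orthogonal projection), (ii) a `(c/2) L⁴`-dark normalised sector
ground state, and hence (iii) `dim E₀(U, L) ≥ 2`. Proof: Baire makes the average bound uniform
(`L ≥ L₁`) on a dense subset of a sub-window of `(a, b)` (`birAvgHyp_uniform_on_dense_subwindow`),
whence the trace floor at EVERY coupling there (`le_re_trace_groundProj_mul_of_mem_closure`, upper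
semicontinuity of the ground multiplet); `exists_darkInterval_of_not_birEveryGroundState` supplies
a `(c/2) L⁴`-dark interval inside it at a side `L ≥ max L₀ L₁`; and on a line the compression of
`Δ_d†Δ_d` is the scalar `re tr (P Δ_d†Δ_d) ≥ c L⁴ > (c/2) L⁴` (`UniqueGround.exists_scalar_of_finrank_one`,
`UniqueGround.le_re_of_scalar_of_average`), so no coupling of the dark interval has a simple ground
state. So a counterexample to the crux lives on ground multiplets of the doped repulsive Hubbard
torus that are degenerate on whole coupling intervals, at infinitely many sizes, while carrying
the average order. Kato (1966) II-§5.1; Baire (1899). [folklore] -/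
theorem exists_degenerateInterval_of_not_birEveryGroundState (hS : ¬ BirEveryGroundState) :
    ∃ (δ U₁ U₂ c : ℝ), δ ∈ Set.Ioo (0:ℝ) (1/2) ∧ 0 < U₁ ∧ U₁ < U₂ ∧ 0 < c ∧
      (∀ U ∈ Set.Ioo U₁ U₂, ∃ L₀ : ℕ, ∀ (L : ℕ) [NeZero L], L₀ ≤ L → Even L →
        let N : ℕ := 2 * ⌊(1 - δ) * (L : ℝ) ^ 2 / 2⌋₊
        let H := hubbardTorus 2 L 1 U
        let S := szSector (Λ := FermionTorus 2 L) N 0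
        let E₀ := S ⊓ Module.End.eigenspace (Matrix.toLin' H) ((H.minEnergyOn S : ℝ) : ℂ)
        let P := projMatrix (E₀.map (Fock.toEuclidean (ι := Orb (FermionTorus 2 L)) :
          Fock (Orb (FermionTorus 2 L)) →ₗ[ℂ] EuclideanSpace ℂ (Finset (Orb (FermionTorus 2 L)))))
        c * (L : ℝ) ^ 4 * P.trace.re ≤
          (P * ((pairField dWaveFormFactor L)ᴴ * pairField dWaveFormFactor L)).trace.re) ∧
      ∀ a b : ℝ, U₁ ≤ a → a < b → b ≤ U₂ → ∀ L₀ : ℕ, ∃ (L : ℕ) (_ : NeZero L), L₀ ≤ L ∧ Even L ∧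
        ∃ u v : ℝ, a ≤ u ∧ u < v ∧ v ≤ b ∧ ∀ U ∈ Set.Ioo u v,
          let N : ℕ := 2 * ⌊(1 - δ) * (L : ℝ) ^ 2 / 2⌋₊
          let H := hubbardTorus 2 L 1 U
          let S := szSector (Λ := FermionTorus 2 L) N 0
          let E₀ := S ⊓ Module.End.eigenspace (Matrix.toLin' H) ((H.minEnergyOn S : ℝ) : ℂ)
          let P := projMatrix (E₀.map (Fock.toEuclidean (ι := Orb (FermionTorus 2 L)) :
            Fock (Orb (FermionTorus 2 L)) →ₗ[ℂ] EuclideanSpace ℂ (Finset (Orb (FermionTorus 2 L)))))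
          c * (L : ℝ) ^ 4 ≤ (P * ((pairField dWaveFormFactor L)ᴴ * pairField dWaveFormFactor L)).trace.re ∧
          (∃ ψ : Fock (Orb (FermionTorus 2 L)), IsGroundStateInSector H N 0 ψ ∧ star ψ ⬝ᵥ ψ = 1 ∧
            (star ψ ⬝ᵥ ((pairField dWaveFormFactor L)ᴴ * pairField dWaveFormFactor L) *ᵥ ψ).re ≤
              c / 2 * (L : ℝ) ^ 4) ∧
          2 ≤ Module.finrank ℂ ↥E₀ := by
  classical
  obtain ⟨δ, U₁, U₂, c, hδ, hU₁, hU₁₂, hc, hyp, hdark⟩ :=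
    exists_darkInterval_of_not_birEveryGroundState hS
  refine ⟨δ, U₁, U₂, c, hδ, hU₁, hU₁₂, hc, hyp, fun a' b' ha' hab' hb' L₀ => ?_⟩
  -- Baire: one threshold `L₁` for the average bound on a dense subset of a sub-window `(a, b)`
  -- of `(a', b')` (the average bound holds on `(a', b') ⊆ (U₁, U₂)`)
  have hyp' : ∀ U ∈ Set.Ioo a' b', ∃ L₀ : ℕ, ∀ (L : ℕ) [NeZero L], L₀ ≤ L → Even L →
      let N : ℕ := 2 * ⌊(1 - δ) * (L : ℝ) ^ 2 / 2⌋₊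
      let H := hubbardTorus 2 L 1 U
      let S := szSector (Λ := FermionTorus 2 L) N 0
      let E₀ := S ⊓ Module.End.eigenspace (Matrix.toLin' H) ((H.minEnergyOn S : ℝ) : ℂ)
      let P := projMatrix (E₀.map (Fock.toEuclidean (ι := Orb (FermionTorus 2 L)) :
        Fock (Orb (FermionTorus 2 L)) →ₗ[ℂ] EuclideanSpace ℂ (Finset (Orb (FermionTorus 2 L)))))
      c * (L : ℝ) ^ 4 * P.trace.re ≤
        (P * ((pairField dWaveFormFactor L)ᴴ * pairField dWaveFormFactor L)).trace.re :=
    fun U hU => hyp U ⟨lt_of_le_of_lt ha' hU.1, lt_of_lt_of_le hU.2 hb'⟩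
  obtain ⟨L₁, a, b, ha, hab, hb, hsub⟩ := birAvgHyp_uniform_on_dense_subwindow hab' hyp'
  -- a `(c/2) L⁴`-dark interval inside `[a, b]` at a side `L ≥ max L₀ L₁`
  obtain ⟨L, hLne, hL, hE, u, v, hu, huv, hv, hdk⟩ :=
    hdark a b (c / 2) (ha'.trans ha.le) hab (hb.le.trans hb') (by positivity) (max L₀ L₁)
  haveI : NeZero L := hLne
  refine ⟨L, hLne, le_of_max_le_left hL, hE, u, v, by linarith, huv, by linarith,
    fun U hUuv => ?_⟩
  dsimp only
  have hLL₁ : L₁ ≤ L := le_of_max_le_right hL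
  -- the objects of side `L`
  set B : Matrix (Finset (Orb (FermionTorus 2 L))) (Finset (Orb (FermionTorus 2 L))) ℂ :=
    (pairField dWaveFormFactor L)ᴴ * pairField dWaveFormFactor L with hB
  set S : Submodule ℂ (Fock (Orb (FermionTorus 2 L))) :=
    szSector (Λ := FermionTorus 2 L) (2 * ⌊(1 - δ) * (L : ℝ) ^ 2 / 2⌋₊) 0 with hS_def
  set D : Matrix (Finset (Orb (FermionTorus 2 L))) (Finset (Orb (FermionTorus 2 L))) ℂ :=
    ∑ x : FermionTorus 2 L, numberOp x 0 * numberOp x 1 with hD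
  -- the pencil `hubbardTorus 2 L 1 w = H(0) + w • D`, Hermitian, preserving `S ≠ ⊥`; `B ≥ 0`
  have hpen : ∀ w : ℝ, hubbardTorus 2 L 1 w = hubbardTorus 2 L 1 0 + (w : ℂ) • D := fun w =>
    hubbardTorus_eq_zero_add_smul_interaction w
  have hHh : ∀ w : ℝ, (hubbardTorus 2 L 1 w).IsHermitian := fun w =>
    hubbardTorus_isHermitian (hamiltonian_isHermitian_and_commute_holds (fermionTorusGraph 2 L))
      1 w
  have hDeq : D = hubbardTorus 2 L 1 1 - hubbardTorus 2 L 1 0 := by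
    rw [hpen 1, Complex.ofReal_one, one_smul, add_sub_cancel_left]
  have hDh : D.IsHermitian := by rw [hDeq]; exact (hHh 1).sub (hHh 0)
  have hSH : ∀ w ∈ S, hubbardTorus 2 L 1 0 *ᵥ w ∈ S := fun w hw =>
    hubbardTorus_mulVec_mem_szSector 1 0 hw
  have hSD : ∀ w ∈ S, D *ᵥ w ∈ S := fun w hw => by
    rw [hDeq, sub_mulVec]
    exact S.sub_mem (hubbardTorus_mulVec_mem_szSector 1 1 hw)
      (hubbardTorus_mulVec_mem_szSector 1 0 hw)
  have hBpsd : B.PosSemidef := Matrix.posSemidef_conjTranspose_mul_self _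
  -- the dark unit ground state at `U`
  obtain ⟨ψ, hgs, hψ1, hψdark⟩ := hdk U hUuv
  set E₀ : Submodule ℂ (Fock (Orb (FermionTorus 2 L))) :=
    S ⊓ Module.End.eigenspace (Matrix.toLin' (hubbardTorus 2 L 1 U))
      (((hubbardTorus 2 L 1 U).minEnergyOn S : ℝ) : ℂ) with hE₀
  have hψE : ψ ∈ E₀ := by
    refine Submodule.mem_inf.mpr ⟨hgs.1, ?_⟩
    rw [Module.End.mem_eigenspace_iff, Matrix.toLin'_apply]
    exact hgs.2.2
  have hSne : S ≠ ⊥ := fun h => hgs.2.1 ((Submodule.eq_bot_iff _).1 h ψ hgs.1)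
  -- `U` lies in the closure of the couplings where the average bound holds for all `L ≥ L₁`
  have hUab : U ∈ Set.Ioo a b := ⟨lt_of_le_of_lt hu hUuv.1, lt_of_lt_of_le hUuv.2 hv⟩
  have hcl := hsub hUab
  -- (i) the trace floor `c L⁴ ≤ re tr (P(U) B)` (upper semicontinuity of the ground multiplet)
  have hfloor : c * (L : ℝ) ^ 4 ≤ (projMatrix (E₀.map
      ((WithLp.linearEquiv 2 ℂ (Finset (Orb (FermionTorus 2 L)) → ℂ)).symm :
        (Finset (Orb (FermionTorus 2 L)) → ℂ) →ₗ[ℂ]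
          EuclideanSpace ℂ (Finset (Orb (FermionTorus 2 L))))) * B).trace.re := by
    refine le_re_trace_groundProj_mul_of_mem_closure (hHh 0) hDh hBpsd S hSH hSD hSne
      (A := fun w => hubbardTorus 2 L 1 w)
      (E := fun w => S ⊓ Module.End.eigenspace (Matrix.toLin' (hubbardTorus 2 L 1 w))
        (((hubbardTorus 2 L 1 w).minEnergyOn S : ℝ) : ℂ))
      (P := fun w => projMatrix ((S ⊓ Module.End.eigenspace
        (Matrix.toLin' (hubbardTorus 2 L 1 w))
          (((hubbardTorus 2 L 1 w).minEnergyOn S : ℝ) : ℂ)).map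
        ((WithLp.linearEquiv 2 ℂ (Finset (Orb (FermionTorus 2 L)) → ℂ)).symm :
          (Finset (Orb (FermionTorus 2 L)) → ℂ) →ₗ[ℂ]
            EuclideanSpace ℂ (Finset (Orb (FermionTorus 2 L))))))
      hpen (fun _ => rfl) (fun _ => rfl) hcl fun w hw => ?_
    exact hw.2 L hLL₁ hE
  refine ⟨hfloor, ⟨ψ, hgs, hψ1, hψdark⟩, ?_⟩
  -- (iii) if `E₀` were a line, the compression of `B` would be the scalar `re tr (P B) ≥ c L⁴` …
  by_contra hlt
  have hE₀ne : E₀ ≠ ⊥ := fun h => hgs.2.1 ((Submodule.eq_bot_iff _).1 h ψ hψE)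
  have hfin : Module.finrank ℂ E₀ = 1 :=
    le_antisymm (by omega) (Submodule.one_le_finrank_iff.mpr hE₀ne)
  have htr : (projMatrix (E₀.map
      ((WithLp.linearEquiv 2 ℂ (Finset (Orb (FermionTorus 2 L)) → ℂ)).symm :
        (Finset (Orb (FermionTorus 2 L)) → ℂ) →ₗ[ℂ]
          EuclideanSpace ℂ (Finset (Orb (FermionTorus 2 L)))))).trace.re = 1 := by
    rw [re_trace_projMatrix_map_eq_finrank, hfin, Nat.cast_one]
  have havg : c * (L : ℝ) ^ 4 * (projMatrix (E₀.map
      ((WithLp.linearEquiv 2 ℂ (Finset (Orb (FermionTorus 2 L)) → ℂ)).symm :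
        (Finset (Orb (FermionTorus 2 L)) → ℂ) →ₗ[ℂ]
          EuclideanSpace ℂ (Finset (Orb (FermionTorus 2 L)))))).trace.re ≤
      (projMatrix (E₀.map
      ((WithLp.linearEquiv 2 ℂ (Finset (Orb (FermionTorus 2 L)) → ℂ)).symm :
        (Finset (Orb (FermionTorus 2 L)) → ℂ) →ₗ[ℂ]
          EuclideanSpace ℂ (Finset (Orb (FermionTorus 2 L))))) * B).trace.re := by
    rw [htr, mul_one]; exact hfloor
  -- … so the dark direction `ψ` would have `c L⁴ ≤ re ⟨ψ, B ψ⟩ ≤ (c/2) L⁴`: contradiction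
  have hge : c * (L : ℝ) ^ 4 ≤ (star ψ ⬝ᵥ B *ᵥ ψ).re :=
    UniqueGround.le_re_of_scalar_of_average E₀ B _
      (UniqueGround.exists_scalar_of_finrank_one E₀ hfin B) havg hψE hψ1
  have hL4 : (0 : ℝ) < (L : ℝ) ^ 4 := by
    have hL0 : (0 : ℝ) < (L : ℝ) := Nat.cast_pos.2 (Nat.pos_of_ne_zero (NeZero.ne L))
    positivity
  nlinarith [hge.trans hψdark]

/-! ### The closure in Lieb's currency: per-side dense simplicity ⇒ the crux -/

/-- **`BirEveryGroundState` ⇐ per-side dense SIMPLICITY on every window carrying the average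
bound.** Suppose that for all data `(δ, U₁, U₂, c)` of the crux and under its window-average
hypothesis there are a sub-window `[a, b] ⊆ [U₁, U₂]` (`a < b`) and a threshold `L₀` such that for
EACH even side `L ≥ L₀` the couplings at which the `(2⌊(1-δ)L²/2⌋, S^z = 0)`-sector ground state of
`hubbardTorus 2 L 1 U` is SIMPLE (`dim E₀(U, L) = 1`, the currency of Lieb's theorems) meet every
sub-interval of `(a, b)`. Then the crux holds — the per-side (Baire) form of
`avgToEvery_at_of_eventualSimplicity`, which needs simplicity at ONE coupling for all large sides:
otherwise `exists_degenerateInterval_of_not_birEveryGroundState` produces, inside `[a, b]` and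
beyond `L₀`, a side and a whole interval of couplings with `dim E₀ ≥ 2`. (For the doped repulsive
torus no simplicity theorem is known; at sides where the ground state carries non-zero crystal
momentum the hypothesis fails by symmetry and `birEveryGroundState_of_denseBright` is the form to
use.) Lieb, PRL 62 (1989) 1201; Kato (1966) II-§5.1. [folklore] -/
theorem birEveryGroundState_of_denseSimple
    (h : ∀ (δ U₁ U₂ c : ℝ), δ ∈ Set.Ioo (0:ℝ) (1/2) → 0 < U₁ → U₁ < U₂ → 0 < c →
      (∀ U ∈ Set.Ioo U₁ U₂, ∃ L₀ : ℕ, ∀ (L : ℕ) [NeZero L], L₀ ≤ L → Even L →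
        let N : ℕ := 2 * ⌊(1 - δ) * (L : ℝ) ^ 2 / 2⌋₊
        let H := hubbardTorus 2 L 1 U
        let S := szSector (Λ := FermionTorus 2 L) N 0
        let E₀ := S ⊓ Module.End.eigenspace (Matrix.toLin' H) ((H.minEnergyOn S : ℝ) : ℂ)
        let P := projMatrix (E₀.map (Fock.toEuclidean (ι := Orb (FermionTorus 2 L)) :
          Fock (Orb (FermionTorus 2 L)) →ₗ[ℂ] EuclideanSpace ℂ (Finset (Orb (FermionTorus 2 L)))))
        c * (L : ℝ) ^ 4 * P.trace.re ≤
          (P * ((pairField dWaveFormFactor L)ᴴ * pairField dWaveFormFactor L)).trace.re) →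
      ∃ a b : ℝ, U₁ ≤ a ∧ a < b ∧ b ≤ U₂ ∧ ∃ L₀ : ℕ,
        ∀ (L : ℕ) [NeZero L], L₀ ≤ L → Even L → ∀ u v : ℝ, a ≤ u → u < v → v ≤ b →
          ∃ U ∈ Set.Ioo u v,
            let N : ℕ := 2 * ⌊(1 - δ) * (L : ℝ) ^ 2 / 2⌋₊
            let H := hubbardTorus 2 L 1 U
            let S := szSector (Λ := FermionTorus 2 L) N 0
            let E₀ := S ⊓ Module.End.eigenspace (Matrix.toLin' H) ((H.minEnergyOn S : ℝ) : ℂ)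
            Module.finrank ℂ ↥E₀ = 1) :
    BirEveryGroundState := by
  by_contra hS
  obtain ⟨δ, U₁, U₂, c, hδ, hU₁, hU₁₂, hc, hyp, hdeg⟩ :=
    exists_degenerateInterval_of_not_birEveryGroundState hS
  obtain ⟨a, b, ha, hab, hb, L₀, hsimple⟩ := h δ U₁ U₂ c hδ hU₁ hU₁₂ hc hyp
  obtain ⟨L, hLne, hL, hE, u, v, hu, huv, hv, hint⟩ := hdeg a b ha hab hb L₀
  haveI : NeZero L := hLne
  obtain ⟨U, hUuv, hfin⟩ := hsimple L hL hE u v hu huv hv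
  have h2 := (hint U hUuv).2.2
  simp only at hfin h2
  omega

end Summit.HubbardSuperconductivity.HubbardSuperconductivity.Theorems
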